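import Literature.MathematicalPhysics.QuantumChemistry.GarrodPercusEigenvalueBound
import HarnessLib

/-!
# The Garrod–Percus constants in the REAL SYMMETRIC programme (`x̄ · 1 − X ⪰ 0` over `ℝ`)

Topic `Literature/MathematicalPhysics/QuantumChemistry`; companion of `GarrodPercusEigenvalueBound.lean`
(the operator bounds `N · 1 − Γ ⪰ 0`, `N · 1 − G ⪰ 0`, `(r − N) · 1 − Q ⪰ 0` on the complex Hermitian
DQG-feasible set) and of `RelaxationRealRestriction.lean` (the programmes may be restricted to REAL
pairs without loss: Braams–Percus–Zhao 2007 ch. 5 §I "If the density matrices are known to be real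
symmetric then the `f_i` may be assumed real"; Fukuda et al. ch. 6 §I: the SDP codes work in "the space
of block-diagonal real symmetric matrices"). HONEST FRAMING (cell chem-oracle, LADDER-CHEM I-TYPE
slot 08): statements about a finite model Hamiltonian's reduced density matrices and their semidefinite
relaxations; this file certifies no number.

WHY THIS FILE. The a-posteriori theorems that consume the a-priori constants are typed over REAL
matrices — `JanssonChaykinKeil.lemma_3_1` / `theorem_3_2` take `hub : (x̄_j • 1 − X_j).PosSemidef` and
`Jansson2007.corollary_6_1a_feasible` takes `hXub`, all in `Matrix n n ℝ` — because the rigorous-bound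
theory is stated for real symmetric block SDPs: Chaykin, Jansson, Keil, Lange, Ohlhus, Rump (2016) §5
Theorem 2, p. 22, "Assume further that upper bounds for the maximal eigenvalues of the primal feasible
solution of (2.5) `λmax(X_j) ≤ x_j` (5.19) are known", for the primal block variable
`X = diag(γ, I−γ, Γ, Q, G, T1, T2)` of §4.1 (4.1) with the constants (4.6), among them the
Garrod–Percus `λmax(Γ) ≤ N` (4.3). [cite: ChaykinEtAl2016RigorousESC, §4.1 eqs. (4.1), (4.3), (4.6), pp. 14-15; §5 Thm 2 (5.19), p. 22]
The primal blocks of the real programme are the ENTRYWISE REAL PARTS `Γ.map re`, `G.map re`,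
`Q.map re` of a feasible pair (for a real pair these are the pair itself; for a complex pair the real
part is again feasible, `IsDQGFeasible.realPart`). This file transports the complex Löwner bounds to
exactly that shape.

WHAT IS PROVED (0 sorry, no definition, no named fact):
* `posSemidef_map_re_of_posSemidef` — a complex positive semidefinite (Hermitian) matrix has a real
  symmetric positive semidefinite entrywise real part (`vᵀ(Re M)v = Re(v*Mv)` for real `v`; Horn–Johnson
  7.6.P8 (a), (d), the semidefinite form);
* `posSemidef_smul_one_sub_map_re` — `c · 1 − A ⪰ 0` over `ℂ` (real `c`) gives `c · 1 − Re A ⪰ 0` over `ℝ`;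
* the three constants in consumer shape: `IsDQGFeasible.posSemidef_natCast_smul_one_sub_two_re`
  (`(N : ℝ) • 1 − Γ.map re ⪰ 0`), `…_gMap_re` (`(N : ℝ) • 1 − (gMap γ Γ).map re ⪰ 0`), `…_qMap_re`
  (`(M : ℝ) • 1 − (qMap γ Γ).map re ⪰ 0`, `N + M = r`); any other bound of the sibling (sub-blocks, spin
  classes) transports by `posSemidef_smul_one_sub_map_re` in one line.
-/

noncomputable section

namespace Literature.MathematicalPhysics.QuantumChemistry

open Matrix Finset Literature.MathematicalPhysics.QuantumLattice
open scoped ComplexOrder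

section RealPart

variable {n : Type*} [Fintype n]

/-- **The entrywise real part of a complex positive semidefinite matrix is a real positive semidefinite
matrix.** Horn–Johnson 7.6.P8: "Let `C ∈ M_n` be Hermitian, and write `C = A + iB` with
`A, B ∈ M_n(ℝ)`. […] (a) Verify that `A` is symmetric and `B` is skew symmetric […] (d) If `C` is positive
definite then `A` is positive definite"; stated here in the positive SEMIdefinite form the relaxation
needs (same one-line argument: `vᵀ A v = Re (v* C v) ≥ 0` for real `v`, and `A = Re C` is symmetric
because `C` is Hermitian). [cite: HornJohnson2013, §7.6 Problem 7.6.P8 (a), (d), p. 503] -/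
theorem posSemidef_map_re_of_posSemidef {M : Matrix n n ℂ} (hM : M.PosSemidef) :
    (M.map Complex.re).PosSemidef := by
  refine PosSemidef.of_dotProduct_mulVec_nonneg ?_ fun x => ?_
  · ext i j
    have h := hM.1.apply i j
    simp only [conjTranspose_apply, map_apply, star_trivial]
    rw [← h, Complex.star_def, Complex.conj_re]
  · have h0 := Complex.nonneg_iff.mp (hM.dotProduct_mulVec_nonneg fun i => (x i : ℂ))
    have hre : (star (fun i => (x i : ℂ)) ⬝ᵥ (M *ᵥ fun i => (x i : ℂ))).re =
        star x ⬝ᵥ (M.map Complex.re *ᵥ x) := by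
      simp only [dotProduct, mulVec, Pi.star_apply, Complex.star_def, Complex.conj_ofReal,
        Complex.re_sum, Complex.re_ofReal_mul, Complex.re_mul_ofReal, map_apply, star_trivial]
    rw [← hre]
    exact h0.1

variable [DecidableEq n]

omit [Fintype n] in
/-- The real part of `c · 1 − A` for real `c` is `c · 1 − Re A` (plumbing). [folklore] -/
private theorem map_re_ofReal_smul_one_sub (c : ℝ) (A : Matrix n n ℂ) :
    ((c : ℂ) • (1 : Matrix n n ℂ) - A).map Complex.re = c • (1 : Matrix n n ℝ) - A.map Complex.re := by
  ext i j
  simp only [map_apply, Matrix.sub_apply, Matrix.smul_apply, Matrix.one_apply, smul_eq_mul,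
    Complex.sub_re, mul_ite, mul_one, mul_zero, apply_ite Complex.re, Complex.ofReal_re,
    Complex.zero_re]

/-- **Transport of a Löwner bound to the real programme**: `c · 1 − A ⪰ 0` over `ℂ` (real `c`) implies
`c · 1 − Re A ⪰ 0` over `ℝ` — the hypothesis shape `hub` / `hXub` of `JanssonChaykinKeil.lemma_3_1`,
`theorem_3_2` and `Jansson2007.corollary_6_1a_feasible` (Chaykin et al. 2016 Thm 2 (5.19)).
[cite: ChaykinEtAl2016RigorousESC, §5 Thm 2 (5.19), p. 22] -/
theorem posSemidef_smul_one_sub_map_re {c : ℝ} {A : Matrix n n ℂ}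
    (h : ((c : ℂ) • (1 : Matrix n n ℂ) - A).PosSemidef) :
    (c • (1 : Matrix n n ℝ) - A.map Complex.re).PosSemidef := by
  rw [← map_re_ofReal_smul_one_sub]
  exact posSemidef_map_re_of_posSemidef h

end RealPart

section Abstract

variable {ι : Type*} [LinearOrder ι] [Fintype ι] {N : ℕ} {γ : Matrix ι ι ℂ}
  {Γ : Matrix (ι × ι) (ι × ι) ℂ}

/-- **Garrod–Percus in the real programme**: `(N : ℝ) · 1 − Re Γ ⪰ 0` on the DQG-feasible set — the
constant `x̄_Γ = N` of (4.6) for the `Γ`-block of `X = diag(γ, I−γ, Γ, Q, G, …)` (4.1), in the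
`hub`/`hXub` shape. [cite: ChaykinEtAl2016RigorousESC, §4.1 eqs. (4.1), (4.3), pp. 14-15] -/
theorem IsDQGFeasible.posSemidef_natCast_smul_one_sub_two_re (h : IsDQGFeasible N γ Γ) :
    ((N : ℝ) • (1 : Matrix (ι × ι) (ι × ι) ℝ) - Γ.map Complex.re).PosSemidef := by
  have h1 := h.posSemidef_natCast_smul_one_sub_two
  rw [← Complex.ofReal_natCast] at h1
  exact posSemidef_smul_one_sub_map_re h1

/-- **`G`-block in the real programme**: `(N : ℝ) · 1 − Re G ⪰ 0` on the DQG-feasible set (operator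
form; sharper than the printed trace constant `N(r−N+1)` of (4.6), see the sibling).
[cite: ChaykinEtAl2016RigorousESC, §4.1 eqs. (4.1), (4.6), pp. 14-15] -/
theorem IsDQGFeasible.posSemidef_natCast_smul_one_sub_gMap_re (h : IsDQGFeasible N γ Γ) :
    ((N : ℝ) • (1 : Matrix (ι × ι) (ι × ι) ℝ) - (gMap γ Γ).map Complex.re).PosSemidef := by
  have h1 := h.posSemidef_natCast_smul_one_sub_gMap
  rw [← Complex.ofReal_natCast] at h1
  exact posSemidef_smul_one_sub_map_re h1

/-- **`Q`-block in the real programme**: for `N + M = r = |ι|`, `(M : ℝ) · 1 − Re Q ⪰ 0` on the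
DQG-feasible set (operator form; sharper than the printed trace constant `(r−N)(r−N−1)` of (4.6)).
[cite: ChaykinEtAl2016RigorousESC, §4.1 eqs. (4.1), (4.6), pp. 14-15] -/
theorem IsDQGFeasible.posSemidef_natCast_smul_one_sub_qMap_re {M : ℕ} (hNM : N + M = Fintype.card ι)
    (h : IsDQGFeasible N γ Γ) :
    ((M : ℝ) • (1 : Matrix (ι × ι) (ι × ι) ℝ) - (qMap γ Γ).map Complex.re).PosSemidef := by
  have h1 := h.posSemidef_natCast_smul_one_sub_qMap hNM
  rw [← Complex.ofReal_natCast] at h1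
  exact posSemidef_smul_one_sub_map_re h1

end Abstract

end Literature.MathematicalPhysics.QuantumChemistry

end
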